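import Mathlib
import Summits.AtomisticToContinuum.FouriersLaw.Theses.EmbeddedDrudeMourre
import Summits.AtomisticToContinuum.FouriersLaw.Theorems.EmbeddedDrudeMourreDrudeDissolutionStubExcursionSecondDifferenceCornerFloorD
import Summits.AtomisticToContinuum.FouriersLaw.Theorems.EmbeddedDrudeMourreDrudeDissolutionStubExcursionSecondDifferenceCriticalSet
import Summits.AtomisticToContinuum.FouriersLaw.Theorems.EmbeddedDrudeMourreDrudeDissolutionStubExcursionSecondDifferenceConcreteRegularity
import Summits.AtomisticToContinuum.FouriersLaw.Theorems.EmbeddedDrudeMourreDrudeDissolutionWeightFactorisation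
import Summits.AtomisticToContinuum.FouriersLaw.Theorems.EmbeddedDrudeMourreDrudeDissolutionStubFreeOddExcursionKernelFGR
import HarnessLib

/-!
# Corner bounds for the excursion weight: `W ≤ C·d∓`, `|∂W| ≤ C·√d∓`, `|∂²W| ≤ C`
# (stub B1b″ of line `kinetic-polymer-gas-on-the-time-axis`, request R4 of the sup-norm engine)
(crux `EmbeddedDrudeMourre.DrudeDissolution`, item stmt-AtomisticToContinuum-12593; `--supports` file, closes
nothing; lead c13)

WHAT (`weight_corner_bounds`, registered). For `ω₂ > 0`, a sine polynomial profile `f = Σ cᵢ sin((i+1)k)`, the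
excursion weight `W p = Φ²/(ω₁ω₂ω₃ω₄)²·[f]²` read at `p = (k₁,(k₃,k₂))`, any three directions `eᵢ`, and the two
corner distance functions `d₋ p = (1 − cos p.1) + (1 − cos p.2.2) + (1 + cos p.2.1)`,
`d₊ p = (1 + cos p.1) + (1 + cos p.2.2) + (1 − cos p.2.1)`, there is `C ≥ 0` with, at EVERY `p ∈ ℝ³`:
`W p ≤ C·d₋ p`, `W p ≤ C·d₊ p`, `|∂_{eᵢ}W(p)| ≤ C·√(d₋ p)`, `|∂_{eᵢ}W(p)| ≤ C·√(d₊ p)`, `|∂_{eⱼ}∂_{eᵢ}W(p)| ≤ C`.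

HOW. `W = G·B²` with `G = Φ²/(Πω)²` and the bracket `B = f(k₁)+f(k₂)−f(k₃)−f(k₄)`, both `C²` and `2π`-periodic
in each coordinate, hence with uniformly bounded values and first/second directional derivatives
(`periodic3_C2_bounds`). `B` vanishes on both corner lattices (`bracket_corner_eq_zero`) and is Lipschitz for the
sup norm (mean value inequality, `opNorm_le_sum_abs_basis`), so `|B p| ≤ 3K‖p − p₀‖∞ ≤ 3Kπ√(d∓ p)` by Jordan
(`2‖p−p₀‖∞²/π² ≤ d∓`, nearest lattice corner `p₀`). The product rule gives the three bounds.
-/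

noncomputable section

open Set Real Topology
open Literature.MathematicalPhysics.KineticTheory
open Literature.MathematicalPhysics.KineticTheory.PhononBoltzmann

namespace Summit.AtomisticToContinuum.FouriersLaw.Theorems.DrudeDissolution.KineticPolymerGasOnTheTimeAxis

/-! ### Distance to the corner lattices versus `d∓` -/

/-- Every point is within sup-distance `π·√(d₋/2)` of the lattice of extremal minima:
`2‖p − p₀‖∞²/π² ≤ d₋ p` for a suitable `p₀ ∈ (0,π,0) + 2πℤ³`. [folklore] -/
theorem exists_corner_minus_norm_sq_le (p : ℝ × ℝ × ℝ) :
    ∃ n₁ n₂ n₃ : ℤ, 2 * ‖p - (2 * Real.pi * n₁, Real.pi + 2 * Real.pi * n₃, 2 * Real.pi * n₂)‖ ^ 2 / Real.pi ^ 2 ≤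
      (1 - Real.cos p.1) + (1 - Real.cos p.2.2) + (1 + Real.cos p.2.1) := by
  have hπ := Real.pi_pos
  obtain ⟨n₁, hn₁⟩ := exists_int_mem_Icc_sub_two_pi_mul p.1
  obtain ⟨n₂, hn₂⟩ := exists_int_mem_Icc_sub_two_pi_mul p.2.2
  obtain ⟨n₃, hn₃⟩ := exists_int_mem_Icc_sub_two_pi_mul (p.2.1 - Real.pi)
  refine ⟨n₁, n₂, n₃, ?_⟩
  set x₁ := p.1 - 2 * Real.pi * n₁ with hx₁
  set x₂ := p.2.2 - 2 * Real.pi * n₂ with hx₂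
  set x₃ := p.2.1 - Real.pi - 2 * Real.pi * n₃ with hx₃
  have habs₁ : |x₁| ≤ Real.pi := abs_le.2 ⟨hn₁.1, hn₁.2⟩
  have habs₂ : |x₂| ≤ Real.pi := abs_le.2 ⟨hn₂.1, hn₂.2⟩
  have habs₃ : |x₃| ≤ Real.pi := abs_le.2 ⟨hn₃.1, hn₃.2⟩
  have hc₁ : Real.cos p.1 = Real.cos x₁ := by
    rw [hx₁, show p.1 - 2 * Real.pi * n₁ = p.1 - n₁ * (2 * Real.pi) by ring, Real.cos_sub_int_mul_two_pi]
  have hc₂ : Real.cos p.2.2 = Real.cos x₂ := by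
    rw [hx₂, show p.2.2 - 2 * Real.pi * n₂ = p.2.2 - n₂ * (2 * Real.pi) by ring, Real.cos_sub_int_mul_two_pi]
  have hc₃ : Real.cos p.2.1 = -Real.cos x₃ := by
    rw [hx₃, show p.2.1 - Real.pi - 2 * Real.pi * n₃ = (p.2.1 - n₃ * (2 * Real.pi)) - Real.pi by ring,
      Real.cos_sub_pi, Real.cos_sub_int_mul_two_pi, neg_neg]
  have hnorm : ‖p - (2 * Real.pi * n₁, Real.pi + 2 * Real.pi * n₃, 2 * Real.pi * n₂)‖ = max |x₁| (max |x₃| |x₂|) := by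
    obtain ⟨a, b, c'⟩ := p
    simp only [Prod.mk_sub_mk]
    rw [norm_triple_eq_max]
    simp only [hx₁, hx₂, hx₃]
    congr 2
    ring_nf
  rw [hnorm, hc₁, hc₂, hc₃]
  have hJ₁ := Literature.Barriers.CriticalPhenomena.LongRangeIsing.two_mul_sq_div_le_one_sub_cos habs₁
  have hJ₂ := Literature.Barriers.CriticalPhenomena.LongRangeIsing.two_mul_sq_div_le_one_sub_cos habs₂
  have hJ₃ := Literature.Barriers.CriticalPhenomena.LongRangeIsing.two_mul_sq_div_le_one_sub_cos habs₃
  have h1 : 0 ≤ 1 - Real.cos x₁ := by linarith [Real.cos_le_one x₁]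
  have h2 : 0 ≤ 1 - Real.cos x₂ := by linarith [Real.cos_le_one x₂]
  have h3 : 0 ≤ 1 - Real.cos x₃ := by linarith [Real.cos_le_one x₃]
  have hm : max |x₁| (max |x₃| |x₂|) ^ 2 = |x₁| ^ 2 ∨ max |x₁| (max |x₃| |x₂|) ^ 2 = |x₃| ^ 2 ∨
      max |x₁| (max |x₃| |x₂|) ^ 2 = |x₂| ^ 2 := by
    rcases le_total |x₁| (max |x₃| |x₂|) with h | h
    · rcases le_total |x₃| |x₂| with h' | h'
      · right; right; rw [max_eq_right h, max_eq_right h']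
      · right; left; rw [max_eq_right h, max_eq_left h']
    · left; rw [max_eq_left h]
  rcases hm with h | h | h <;> rw [h, sq_abs] <;> linarith

/-- Every point is within sup-distance `π·√(d₊/2)` of the lattice of extremal maxima:
`2‖p − p₀‖∞²/π² ≤ d₊ p` for a suitable `p₀ ∈ (π,0,π) + 2πℤ³`. [folklore] -/
theorem exists_corner_plus_norm_sq_le (p : ℝ × ℝ × ℝ) :
    ∃ n₁ n₂ n₃ : ℤ,
      2 * ‖p - (Real.pi + 2 * Real.pi * n₁, 2 * Real.pi * n₃, Real.pi + 2 * Real.pi * n₂)‖ ^ 2 / Real.pi ^ 2 ≤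
      (1 + Real.cos p.1) + (1 + Real.cos p.2.2) + (1 - Real.cos p.2.1) := by
  have hπ := Real.pi_pos
  obtain ⟨n₁, hn₁⟩ := exists_int_mem_Icc_sub_two_pi_mul (p.1 - Real.pi)
  obtain ⟨n₂, hn₂⟩ := exists_int_mem_Icc_sub_two_pi_mul (p.2.2 - Real.pi)
  obtain ⟨n₃, hn₃⟩ := exists_int_mem_Icc_sub_two_pi_mul p.2.1
  refine ⟨n₁, n₂, n₃, ?_⟩
  set x₁ := p.1 - Real.pi - 2 * Real.pi * n₁ with hx₁
  set x₂ := p.2.2 - Real.pi - 2 * Real.pi * n₂ with hx₂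
  set x₃ := p.2.1 - 2 * Real.pi * n₃ with hx₃
  have habs₁ : |x₁| ≤ Real.pi := abs_le.2 ⟨hn₁.1, hn₁.2⟩
  have habs₂ : |x₂| ≤ Real.pi := abs_le.2 ⟨hn₂.1, hn₂.2⟩
  have habs₃ : |x₃| ≤ Real.pi := abs_le.2 ⟨hn₃.1, hn₃.2⟩
  have hc₁ : Real.cos p.1 = -Real.cos x₁ := by
    rw [hx₁, show p.1 - Real.pi - 2 * Real.pi * n₁ = (p.1 - n₁ * (2 * Real.pi)) - Real.pi by ring,
      Real.cos_sub_pi, Real.cos_sub_int_mul_two_pi, neg_neg]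
  have hc₂ : Real.cos p.2.2 = -Real.cos x₂ := by
    rw [hx₂, show p.2.2 - Real.pi - 2 * Real.pi * n₂ = (p.2.2 - n₂ * (2 * Real.pi)) - Real.pi by ring,
      Real.cos_sub_pi, Real.cos_sub_int_mul_two_pi, neg_neg]
  have hc₃ : Real.cos p.2.1 = Real.cos x₃ := by
    rw [hx₃, show p.2.1 - 2 * Real.pi * n₃ = p.2.1 - n₃ * (2 * Real.pi) by ring, Real.cos_sub_int_mul_two_pi]
  have hnorm : ‖p - (Real.pi + 2 * Real.pi * n₁, 2 * Real.pi * n₃, Real.pi + 2 * Real.pi * n₂)‖ =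
      max |x₁| (max |x₃| |x₂|) := by
    obtain ⟨a, b, c'⟩ := p
    simp only [Prod.mk_sub_mk]
    rw [norm_triple_eq_max]
    simp only [hx₁, hx₂, hx₃]
    congr 2
    · ring_nf
    · congr 1; ring_nf
  rw [hnorm, hc₁, hc₂, hc₃]
  have hJ₁ := Literature.Barriers.CriticalPhenomena.LongRangeIsing.two_mul_sq_div_le_one_sub_cos habs₁
  have hJ₂ := Literature.Barriers.CriticalPhenomena.LongRangeIsing.two_mul_sq_div_le_one_sub_cos habs₂
  have hJ₃ := Literature.Barriers.CriticalPhenomena.LongRangeIsing.two_mul_sq_div_le_one_sub_cos habs₃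
  have h1 : 0 ≤ 1 - Real.cos x₁ := by linarith [Real.cos_le_one x₁]
  have h2 : 0 ≤ 1 - Real.cos x₂ := by linarith [Real.cos_le_one x₂]
  have h3 : 0 ≤ 1 - Real.cos x₃ := by linarith [Real.cos_le_one x₃]
  have hm : max |x₁| (max |x₃| |x₂|) ^ 2 = |x₁| ^ 2 ∨ max |x₁| (max |x₃| |x₂|) ^ 2 = |x₃| ^ 2 ∨
      max |x₁| (max |x₃| |x₂|) ^ 2 = |x₂| ^ 2 := by
    rcases le_total |x₁| (max |x₃| |x₂|) with h | h
    · rcases le_total |x₃| |x₂| with h' | h'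
      · right; right; rw [max_eq_right h, max_eq_right h']
      · right; left; rw [max_eq_right h, max_eq_left h']
    · left; rw [max_eq_left h]
  rcases hm with h | h | h <;> rw [h, sq_abs] <;> linarith

/-- From `2m²/π² ≤ d` to `m ≤ π·√d`. [folklore] -/
theorem le_pi_mul_sqrt_of_two_mul_sq_div_le {m d : ℝ} (hm : 0 ≤ m) (h : 2 * m ^ 2 / Real.pi ^ 2 ≤ d) :
    m ≤ Real.pi * Real.sqrt d := by
  have hπ := Real.pi_pos
  have hπ2 : 0 < Real.pi ^ 2 := by positivity
  have hd : m ^ 2 ≤ Real.pi ^ 2 * d := by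
    have := (div_le_iff₀ hπ2).1 h
    nlinarith [sq_nonneg m]
  calc m = Real.sqrt (m ^ 2) := (Real.sqrt_sq hm).symm
    _ ≤ Real.sqrt (Real.pi ^ 2 * d) := Real.sqrt_le_sqrt hd
    _ = Real.pi * Real.sqrt d := by rw [Real.sqrt_mul (by positivity), Real.sqrt_sq hπ.le]

/-! ### The product rule for `W = G·B²` applied to a direction -/

/-- `∂ᵥ(G·B²) = ∂ᵥG·B² + 2·G·B·∂ᵥB`. [folklore] -/
theorem fderiv_mul_sq_apply {G B : ℝ × ℝ × ℝ → ℝ} {p : ℝ × ℝ × ℝ} (hG : DifferentiableAt ℝ G p)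
    (hB : DifferentiableAt ℝ B p) (v : ℝ × ℝ × ℝ) :
    fderiv ℝ (fun q => G q * B q ^ 2) p v = fderiv ℝ G p v * B p ^ 2 + 2 * G p * B p * fderiv ℝ B p v := by
  have h := hG.hasFDerivAt.mul (hB.hasFDerivAt.mul hB.hasFDerivAt)
  have hfun : (fun q => G q * B q ^ 2) = G * (B * B) := by
    funext q; simp only [Pi.mul_apply]; ring
  rw [hfun, h.fderiv]
  simp only [add_apply, smul_apply, smul_eq_mul, Pi.mul_apply]
  ring

/-! ### The corner bounds -/

/-- **Registered sub-goal `weight_corner_bounds` (request R4): corner bounds for the excursion weight.** See the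
module docstring. [folklore] -/
theorem weight_corner_bounds :
    ∀ ω₂ a b : ℝ, 0 < ω₂ → ∀ (M : ℕ) (c : Fin M → ℝ) (f : ℝ → ℝ) (W : ℝ × ℝ × ℝ → ℝ),
      (∀ k, f k = ∑ i, c i * Real.sin (((i : ℕ) + 1 : ℕ) * k)) →
      (∀ p : ℝ × ℝ × ℝ, W p = vertex a b p.1 p.2.2 p.2.1 ^ 2 /
          (dispersion ω₂ p.1 * dispersion ω₂ p.2.2 * dispersion ω₂ p.2.1 * dispersion ω₂ (p.1 + p.2.2 - p.2.1)) ^ 2 *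
        (f p.1 + f p.2.2 - f p.2.1 - f (p.1 + p.2.2 - p.2.1)) ^ 2) →
      ∀ e : Fin 3 → ℝ × ℝ × ℝ, ∃ C : ℝ, 0 ≤ C ∧ ∀ p : ℝ × ℝ × ℝ,
        W p ≤ C * ((1 - Real.cos p.1) + (1 - Real.cos p.2.2) + (1 + Real.cos p.2.1)) ∧
        W p ≤ C * ((1 + Real.cos p.1) + (1 + Real.cos p.2.2) + (1 - Real.cos p.2.1)) ∧
        (∀ i, |fderiv ℝ W p (e i)| ≤ C * Real.sqrt ((1 - Real.cos p.1) + (1 - Real.cos p.2.2) + (1 + Real.cos p.2.1)) ∧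
          |fderiv ℝ W p (e i)| ≤ C * Real.sqrt ((1 + Real.cos p.1) + (1 + Real.cos p.2.2) + (1 - Real.cos p.2.1))) ∧
        (∀ i j, |fderiv ℝ (fun q => fderiv ℝ W q (e i)) p (e j)| ≤ C) := by
  intro ω₂ a b hω M c f W hf hW e
  have hπ := Real.pi_pos
  have h2π : (0 : ℝ) < 2 * Real.pi := by positivity
  have hper := dispersion_periodic ω₂
  -- the profile: smooth, periodic, odd
  have hfdef : f = fun k : ℝ => ∑ i, c i * Real.sin (((i : ℕ) + 1 : ℕ) * k) := funext hf
  have hfC : ContDiff ℝ 2 f := by rw [hfdef]; exact fgr_contDiff_sinePoly M c 2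
  have hfper : Function.Periodic f (2 * Real.pi) := by rw [hfdef]; exact fgr_periodic_sinePoly M c
  have hfodd : ∀ x, f (-x) = -f x := fun x => by
    rw [hf, hf, ← Finset.sum_neg_distrib]
    refine Finset.sum_congr rfl fun i _ => ?_
    rw [mul_neg, Real.sin_neg, mul_neg]
  -- the two factors
  set G : ℝ × ℝ × ℝ → ℝ := fun p => vertex a b p.1 p.2.2 p.2.1 ^ 2 /
      (dispersion ω₂ p.1 * dispersion ω₂ p.2.2 * dispersion ω₂ p.2.1 * dispersion ω₂ (p.1 + p.2.2 - p.2.1)) ^ 2 with hG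
  set B : ℝ × ℝ × ℝ → ℝ := fun p => f p.1 + f p.2.2 - f p.2.1 - f (p.1 + p.2.2 - p.2.1) with hB
  have hWGB : ∀ p, W p = G p * B p ^ 2 := fun p => by rw [hW]
  have hWfun : W = fun q => G q * B q ^ 2 := funext hWGB
  -- regularity
  have hd := dispersion_contDiff hω 2
  have c1 : ContDiff ℝ 2 fun p : ℝ × ℝ × ℝ => p.1 := contDiff_fst
  have c2 : ContDiff ℝ 2 fun p : ℝ × ℝ × ℝ => p.2.1 := contDiff_fst.comp contDiff_snd
  have c3 : ContDiff ℝ 2 fun p : ℝ × ℝ × ℝ => p.2.2 := contDiff_snd.comp contDiff_snd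
  have c4 : ContDiff ℝ 2 fun p : ℝ × ℝ × ℝ => p.1 + p.2.2 - p.2.1 := (c1.add c3).sub c2
  have hD0 : ∀ p : ℝ × ℝ × ℝ, (dispersion ω₂ p.1 * dispersion ω₂ p.2.2 * dispersion ω₂ p.2.1 *
      dispersion ω₂ (p.1 + p.2.2 - p.2.1)) ^ 2 ≠ 0 := fun p =>
    pow_ne_zero _ (mul_pos (mul_pos (mul_pos (dispersion_pos hω _) (dispersion_pos hω _))
      (dispersion_pos hω _)) (dispersion_pos hω _)).ne'
  have hGC : ContDiff ℝ 2 G := by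
    have hV := (vertex_cell_contDiff a b 2).pow 2
    have hD : ContDiff ℝ 2 fun p : ℝ × ℝ × ℝ => (dispersion ω₂ p.1 * dispersion ω₂ p.2.2 * dispersion ω₂ p.2.1 *
        dispersion ω₂ (p.1 + p.2.2 - p.2.1)) ^ 2 :=
      ((((hd.comp c1).mul (hd.comp c3)).mul (hd.comp c2)).mul (hd.comp c4)).pow 2
    exact hV.div hD hD0
  have hBC : ContDiff ℝ 2 B := (((hfC.comp c1).add (hfC.comp c3)).sub (hfC.comp c2)).sub (hfC.comp c4)
  have hWC : ContDiff ℝ 2 W := by rw [hWfun]; exact hGC.mul (hBC.pow 2)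
  -- periodicity (format of `periodic3_C2_bounds`)
  have PG1 : ∀ q : ℝ × ℝ × ℝ, G (q + (2 * Real.pi, 0, 0)) = G q := fun q => by
    obtain ⟨x, y, z⟩ := q
    simp only [hG, Prod.mk_add_mk, add_zero]
    rw [vertex_periodic₁, hper, show x + 2 * Real.pi + z - y = (x + z - y) + 2 * Real.pi by ring, hper]
  have PG2 : ∀ q : ℝ × ℝ × ℝ, G (q + (0, 2 * Real.pi, 0)) = G q := fun q => by
    obtain ⟨x, y, z⟩ := q
    simp only [hG, Prod.mk_add_mk, add_zero]
    rw [vertex_periodic₃, hper, show x + z - (y + 2 * Real.pi) = (x + z - y) - 2 * Real.pi by ring, hper.sub_eq]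
  have PG3 : ∀ q : ℝ × ℝ × ℝ, G (q + (0, 0, 2 * Real.pi)) = G q := fun q => by
    obtain ⟨x, y, z⟩ := q
    simp only [hG, Prod.mk_add_mk, add_zero]
    rw [vertex_periodic₂, hper, show x + (z + 2 * Real.pi) - y = (x + z - y) + 2 * Real.pi by ring, hper]
  have PB1 : ∀ q : ℝ × ℝ × ℝ, B (q + (2 * Real.pi, 0, 0)) = B q := fun q => by
    obtain ⟨x, y, z⟩ := q
    simp only [hB, Prod.mk_add_mk, add_zero]
    rw [hfper, show x + 2 * Real.pi + z - y = (x + z - y) + 2 * Real.pi by ring, hfper]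
  have PB2 : ∀ q : ℝ × ℝ × ℝ, B (q + (0, 2 * Real.pi, 0)) = B q := fun q => by
    obtain ⟨x, y, z⟩ := q
    simp only [hB, Prod.mk_add_mk, add_zero]
    rw [hfper, show x + z - (y + 2 * Real.pi) = (x + z - y) - 2 * Real.pi by ring, hfper.sub_eq]
  have PB3 : ∀ q : ℝ × ℝ × ℝ, B (q + (0, 0, 2 * Real.pi)) = B q := fun q => by
    obtain ⟨x, y, z⟩ := q
    simp only [hB, Prod.mk_add_mk, add_zero]
    rw [hfper, show x + (z + 2 * Real.pi) - y = (x + z - y) + 2 * Real.pi by ring, hfper]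
  have PW1 : ∀ q : ℝ × ℝ × ℝ, W (q + (2 * Real.pi, 0, 0)) = W q := fun q => by rw [hWGB, hWGB, PG1, PB1]
  have PW2 : ∀ q : ℝ × ℝ × ℝ, W (q + (0, 2 * Real.pi, 0)) = W q := fun q => by rw [hWGB, hWGB, PG2, PB2]
  have PW3 : ∀ q : ℝ × ℝ × ℝ, W (q + (0, 0, 2 * Real.pi)) = W q := fun q => by rw [hWGB, hWGB, PG3, PB3]
  -- uniform bounds
  obtain ⟨CG, hCG0, hCG⟩ := periodic3_C2_bounds hGC h2π PG1 PG2 PG3 e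
  obtain ⟨CB, hCB0, hCB⟩ := periodic3_C2_bounds hBC h2π PB1 PB2 PB3 e
  obtain ⟨CB', hCB'0, hCB'⟩ := periodic3_C2_bounds hBC h2π PB1 PB2 PB3 ![(1, 0, 0), (0, 1, 0), (0, 0, 1)]
  obtain ⟨CW, hCW0, hCW⟩ := periodic3_C2_bounds hWC h2π PW1 PW2 PW3 e
  set K : ℝ := CG + CB + CB' + CW + 1 with hK
  have hKG : CG ≤ K := by rw [hK]; linarith
  have hKB : CB ≤ K := by rw [hK]; linarith
  have hKB' : CB' ≤ K := by rw [hK]; linarith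
  have hKW : CW ≤ K := by rw [hK]; linarith
  have hK1 : 1 ≤ K := by rw [hK]; linarith
  have hK0 : 0 ≤ K := by linarith
  -- `B` is `3K`-Lipschitz for the sup norm
  have hBd : Differentiable ℝ B := hBC.differentiable (by norm_num)
  have hGd : Differentiable ℝ G := hGC.differentiable (by norm_num)
  have hlip : ∀ p q : ℝ × ℝ × ℝ, |B p - B q| ≤ 3 * K * ‖p - q‖ := by
    intro p q
    have hbound : ∀ x ∈ (Set.univ : Set (ℝ × ℝ × ℝ)), ‖fderiv ℝ B x‖ ≤ 3 * K := fun x _ => by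
      have h := opNorm_le_sum_abs_basis (fderiv ℝ B x)
      have h1 := (hCB' x).2.1 0
      have h2 := (hCB' x).2.1 1
      have h3 := (hCB' x).2.1 2
      simp only [Matrix.cons_val_zero, Matrix.cons_val_one] at h1 h2
      have h3' : |fderiv ℝ B x (0, 0, 1)| ≤ CB' := by simpa using h3
      linarith
    have h := convex_univ.norm_image_sub_le_of_norm_fderiv_le (fun x _ => hBd x) hbound (mem_univ q) (mem_univ p)
    rwa [Real.norm_eq_abs] at h
  -- `|B p| ≤ 3Kπ √d∓`
  have hBminus : ∀ p : ℝ × ℝ × ℝ, |B p| ≤ 3 * K * Real.pi *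
      Real.sqrt ((1 - Real.cos p.1) + (1 - Real.cos p.2.2) + (1 + Real.cos p.2.1)) := by
    intro p
    obtain ⟨n₁, n₂, n₃, hn⟩ := exists_corner_minus_norm_sq_le p
    have h0 : B (2 * Real.pi * n₁, Real.pi + 2 * Real.pi * n₃, 2 * Real.pi * n₂) = 0 := by
      simp only [hB]
      exact (bracket_corner_eq_zero f hfodd hfper n₁ n₂ n₃).1
    have h1 := hlip p (2 * Real.pi * n₁, Real.pi + 2 * Real.pi * n₃, 2 * Real.pi * n₂)
    rw [h0, sub_zero] at h1
    have h2 := le_pi_mul_sqrt_of_two_mul_sq_div_le (norm_nonneg _) hn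
    calc |B p| ≤ 3 * K * ‖p - (2 * Real.pi * n₁, Real.pi + 2 * Real.pi * n₃, 2 * Real.pi * n₂)‖ := h1
      _ ≤ 3 * K * (Real.pi * Real.sqrt ((1 - Real.cos p.1) + (1 - Real.cos p.2.2) + (1 + Real.cos p.2.1))) := by
          gcongr
      _ = _ := by ring
  have hBplus : ∀ p : ℝ × ℝ × ℝ, |B p| ≤ 3 * K * Real.pi *
      Real.sqrt ((1 + Real.cos p.1) + (1 + Real.cos p.2.2) + (1 - Real.cos p.2.1)) := by
    intro p
    obtain ⟨n₁, n₂, n₃, hn⟩ := exists_corner_plus_norm_sq_le p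
    have h0 : B (Real.pi + 2 * Real.pi * n₁, 2 * Real.pi * n₃, Real.pi + 2 * Real.pi * n₂) = 0 := by
      simp only [hB]
      exact (bracket_corner_eq_zero f hfodd hfper n₁ n₂ n₃).2
    have h1 := hlip p (Real.pi + 2 * Real.pi * n₁, 2 * Real.pi * n₃, Real.pi + 2 * Real.pi * n₂)
    rw [h0, sub_zero] at h1
    have h2 := le_pi_mul_sqrt_of_two_mul_sq_div_le (norm_nonneg _) hn
    calc |B p| ≤ 3 * K * ‖p - (Real.pi + 2 * Real.pi * n₁, 2 * Real.pi * n₃, Real.pi + 2 * Real.pi * n₂)‖ := h1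
      _ ≤ 3 * K * (Real.pi * Real.sqrt ((1 + Real.cos p.1) + (1 + Real.cos p.2.2) + (1 - Real.cos p.2.1))) := by
          gcongr
      _ = _ := by ring
  -- the generic estimates from `|B p| ≤ 3Kπ·s`, `s² = d`
  have hvalue : ∀ (p : ℝ × ℝ × ℝ) (d : ℝ), 0 ≤ d → |B p| ≤ 3 * K * Real.pi * Real.sqrt d →
      W p ≤ 9 * Real.pi ^ 2 * K ^ 3 * d := by
    intro p d hd0 hBs
    have hs := Real.sq_sqrt hd0
    have hG1 : |G p| ≤ K := ((hCG p).1).trans hKG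
    have hB2 : B p ^ 2 ≤ (3 * K * Real.pi) ^ 2 * d := by
      have := pow_le_pow_left₀ (abs_nonneg _) hBs 2
      rw [sq_abs] at this
      calc B p ^ 2 ≤ (3 * K * Real.pi * Real.sqrt d) ^ 2 := this
        _ = (3 * K * Real.pi) ^ 2 * d := by rw [mul_pow, hs]
    rw [hWGB]
    calc G p * B p ^ 2 ≤ |G p| * B p ^ 2 := by
          exact mul_le_mul_of_nonneg_right (le_abs_self _) (sq_nonneg _)
      _ ≤ K * ((3 * K * Real.pi) ^ 2 * d) := by gcongr
      _ = 9 * Real.pi ^ 2 * K ^ 3 * d := by ring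
  have hderiv : ∀ (p : ℝ × ℝ × ℝ) (d : ℝ), 0 ≤ d → |B p| ≤ 3 * K * Real.pi * Real.sqrt d →
      ∀ i, |fderiv ℝ W p (e i)| ≤ 9 * Real.pi * K ^ 3 * Real.sqrt d := by
    intro p d hd0 hBs i
    have hG1 : |G p| ≤ K := ((hCG p).1).trans hKG
    have hG2 : |fderiv ℝ G p (e i)| ≤ K := ((hCG p).2.1 i).trans hKG
    have hB1 : |B p| ≤ K := ((hCB p).1).trans hKB
    have hB3 : |fderiv ℝ B p (e i)| ≤ K := ((hCB p).2.1 i).trans hKB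
    rw [hWfun, fderiv_mul_sq_apply (hGd p) (hBd p)]
    have hs0 : 0 ≤ Real.sqrt d := Real.sqrt_nonneg d
    have hBa := abs_nonneg (B p)
    calc |fderiv ℝ G p (e i) * B p ^ 2 + 2 * G p * B p * fderiv ℝ B p (e i)|
        ≤ |fderiv ℝ G p (e i) * B p ^ 2| + |2 * G p * B p * fderiv ℝ B p (e i)| := abs_add_le _ _
      _ = |fderiv ℝ G p (e i)| * |B p| * |B p| + 2 * |G p| * |B p| * |fderiv ℝ B p (e i)| := by
          rw [abs_mul, abs_mul, abs_mul, abs_mul, abs_pow, abs_two]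
          ring
      _ ≤ K * K * |B p| + 2 * K * |B p| * K := by
          gcongr
      _ = 3 * K ^ 2 * |B p| := by ring
      _ ≤ 3 * K ^ 2 * (3 * K * Real.pi * Real.sqrt d) := by gcongr
      _ = 9 * Real.pi * K ^ 3 * Real.sqrt d := by ring
  -- the constant
  refine ⟨9 * Real.pi ^ 2 * K ^ 3 + 9 * Real.pi * K ^ 3 + K, by positivity, fun p => ⟨?_, ?_, fun i => ⟨?_, ?_⟩, fun i j => ?_⟩⟩
  · have hd0 : 0 ≤ (1 - Real.cos p.1) + (1 - Real.cos p.2.2) + (1 + Real.cos p.2.1) := by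
      linarith [Real.cos_le_one p.1, Real.cos_le_one p.2.2, Real.neg_one_le_cos p.2.1]
    have h := hvalue p _ hd0 (hBminus p)
    have hK3 : 0 ≤ (9 * Real.pi * K ^ 3 + K) * ((1 - Real.cos p.1) + (1 - Real.cos p.2.2) + (1 + Real.cos p.2.1)) := by
      positivity
    linarith
  · have hd0 : 0 ≤ (1 + Real.cos p.1) + (1 + Real.cos p.2.2) + (1 - Real.cos p.2.1) := by
      linarith [Real.neg_one_le_cos p.1, Real.neg_one_le_cos p.2.2, Real.cos_le_one p.2.1]
    have h := hvalue p _ hd0 (hBplus p)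
    have hK3 : 0 ≤ (9 * Real.pi * K ^ 3 + K) * ((1 + Real.cos p.1) + (1 + Real.cos p.2.2) + (1 - Real.cos p.2.1)) := by
      positivity
    linarith
  · have hd0 : 0 ≤ (1 - Real.cos p.1) + (1 - Real.cos p.2.2) + (1 + Real.cos p.2.1) := by
      linarith [Real.cos_le_one p.1, Real.cos_le_one p.2.2, Real.neg_one_le_cos p.2.1]
    have h := hderiv p _ hd0 (hBminus p) i
    have hK3 : 0 ≤ (9 * Real.pi ^ 2 * K ^ 3 + K) *
        Real.sqrt ((1 - Real.cos p.1) + (1 - Real.cos p.2.2) + (1 + Real.cos p.2.1)) := by positivity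
    linarith
  · have hd0 : 0 ≤ (1 + Real.cos p.1) + (1 + Real.cos p.2.2) + (1 - Real.cos p.2.1) := by
      linarith [Real.neg_one_le_cos p.1, Real.neg_one_le_cos p.2.2, Real.cos_le_one p.2.1]
    have h := hderiv p _ hd0 (hBplus p) i
    have hK3 : 0 ≤ (9 * Real.pi ^ 2 * K ^ 3 + K) *
        Real.sqrt ((1 + Real.cos p.1) + (1 + Real.cos p.2.2) + (1 - Real.cos p.2.1)) := by positivity
    linarith
  · have h := ((hCW p).2.2 i j).trans hKW
    have : 0 ≤ 9 * Real.pi ^ 2 * K ^ 3 + 9 * Real.pi * K ^ 3 := by positivity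
    linarith

end Summit.AtomisticToContinuum.FouriersLaw.Theorems.DrudeDissolution.KineticPolymerGasOnTheTimeAxis

end
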